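import Literature.Probability.Percolation.ArmExponentsFourArmProofs
import HarnessLib

/-!
# The four-arm exponent from eventual upper/lower bounds at fixed ratio (portmanteau form of SW's (16))

Topic `Literature/Probability/Percolation`; family `crit-perc`. Third proof-only companion of
`ArmExponents.lean` for the named fact `Literature.Probability.Percolation.fourArm_exponent`
(S. Smirnov, W. Werner, *Critical exponents for two-dimensional percolation*, Math. Res. Lett. 8
(2001) 729–744; Thm. 4 of the arXiv text `math/0109120`, `j = 4`), after
`ArmExponentsFourArm.lean` (the proved product-of-scales assembly
`ArmExponentAssembly.hasDecayExponent_of_scales`, hypothesis (A) = two-sided scale bounds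
`K^{-α-ε} ≤ b(4σ, Kσ) ≤ K^{-α+ε}`) and `ArmExponentsFourArmProofs.lean` (the scale bounds from the
existence of the limits `lim_σ b(4σ, Kσ) = g(K)`, `ArmExponentAssembly.scaleBounds_of_natLimit`,
i.e. Smirnov–Werner's (16) "`b_j(ρ r, ρ R)` has a scaling limit" read on integer data).

What is proved here (theorems only; no definition, no named fact). Smirnov–Werner's continuum
input (A) is used by the assembly only through the scale bounds, and these do NOT require the
discrete probabilities `b(4σ, Kσ)` to converge: it suffices that they are eventually squeezed
between a lower function `g⁻(K)` and an upper function `g⁺(K)` both of logarithmic exponent `-α`,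

  `∀ u > g⁺(K), ∀ᶠ σ, b(4σ, Kσ) < u`  and  `∀ l < g⁻(K), ∀ᶠ σ, l < b(4σ, Kσ)`

(`ArmExponentAssembly.scaleBounds_of_eventualBounds`). This is exactly the shape delivered by the
portmanteau theorem (Billingsley 1999, Thm. 2.1: `limsup_δ P_δ(F) ≤ P'(F)` for closed `F`,
`liminf_δ P_δ(G) ≥ P'(G)` for open `G`; Mathlib
`MeasureTheory.ProbabilityMeasure.limsup_measure_closed_le_of_tendsto` /
`MeasureTheory.ProbabilityMeasure.le_liminf_measure_open_of_tendsto`, then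
`Filter.eventually_lt_of_limsup_lt` / `Filter.eventually_lt_of_lt_liminf`) applied to a closed
continuum event containing, and an open continuum event contained in, the image of the discrete
four-arm event of the annulus `Λ_{Kσ} ∖ Λ_{4σ}` at mesh `σ⁻¹` — with `g⁺(K)`, `g⁻(K)` the
limiting probabilities of these two events. Consequently the "no-touching" (continuity-set)
property of the scaling limit, which `TwoArmScalingLimitFromLoops.lean` needs in order to obtain
the existence of the limits in the two-arm case, is not needed for the exponent: only the
continuum exponents of the closed and of the open event are (both `5/4` for `j = 4`, Smirnov–Werner
(9) with (13)–(15): the radial `SLE₆` derivative exponent `ν(1) = 5/4` of Lawler–Schramm–Werner).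

* `ArmExponentAssembly.scaleBounds_of_eventualBounds` — abstract, for any two-radius sequence `b`.
* `fourArm_exponent_of_eventualBounds_crit` — eventual bounds for `π₄(4σ, Kσ)` with exponents
  `-5/4` and the critical quasi-multiplicativity (SW (10)) imply `fourArm_exponent`.
* `fourArm_exponent_of_eventualBounds` — the same with the quasi-multiplicativity read off from the
  named fact `Werner2009_fourArm_quasiMult` (`critFourArmProb_quasiMult_of_fact`).
* `ArmExponentAssembly.eventualBounds_of_natLimit` — sanity check: limits `g(K)` give eventual
  bounds with `g⁻ = g⁺ = g`, so the present form generalises `scaleBounds_of_natLimit`.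

What remains for `fourArm_exponent_holds` is unchanged in substance (see
`ArmExponentsFourArmProofs.lean`): the continuum input (here in its weakest, portmanteau-ready
form) and the four-arm quasi-multiplicativity / separation at `p = 1/2`.

## References

* S. Smirnov, W. Werner, Math. Res. Lett. 8 (2001) 729–744; arXiv:math/0109120, Thm. 4, §4 (9),
  (10), (13)–(16) and p. 5 (assembly) [SmirnovWernerMRL2001].
* P. Billingsley, *Convergence of probability measures*, 2nd ed. (1999), Thm. 2.1 (portmanteau)
  [Billingsley1999].
* W. Werner, *Lectures on two-dimensional critical percolation*, IAS/Park City Math. Ser. 16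
  (2009), Lecture 5, Thm. 5.2; Lecture 6, Cor. 6.2 [WernerPCMI2009].

Mathlib: `Filter.Tendsto`, `Filter.Eventually`, `Real.log`, `Real.rpow`. Tree:
`ArmExponentAssembly.hasDecayExponent_of_scales`, `fourArm_exponent_of_scaleBounds_crit`,
`critFourArmProb_quasiMult_of_fact`, `critFourArmProb`, `Werner2009_fourArm_quasiMult`.
-/

noncomputable section

open Filter
open _root_.Topology

namespace Literature.Probability.Percolation

open LatticeModels

/-! ### Scale bounds from eventual upper/lower bounds at fixed ratio (abstract assembly) -/

namespace ArmExponentAssembly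

/-- **Scale bounds from eventual bounds.** Let `b` be a two-radius sequence and suppose that for
every integer ratio `K > 4` the values `b(4σ, Kσ)` are eventually below every `u > g⁺(K)` and
eventually above every `l < g⁻(K)` (i.e. `limsup_σ b(4σ, Kσ) ≤ g⁺(K)` and
`g⁻(K) ≤ liminf_σ b(4σ, Kσ)`, the output of the portmanteau theorem), where `g⁻ ≥ 0` and both
`log g⁺(K) / log K → -α` and `log g⁻(K) / log K → -α` along the integers, `α > 0`. Then the
two-sided scale bounds (A) of `hasDecayExponent_of_scales` hold: for every `ε > 0`, for all large
`K` and then all large `σ`, `K^{-α-ε} ≤ b(4σ, Kσ) ≤ K^{-α+ε}`. Elementary (`g⁻(K) > 0` for large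
`K` since `log 0 = 0`; a nonpositive `g⁺(K)` is harmless). The integer-data, limit-free form of
Smirnov–Werner's use of (16) with (9). [cite: SmirnovWernerMRL2001, §4 (9) and (16)] -/
theorem scaleBounds_of_eventualBounds (b : ℕ → ℕ → ℝ) (gl gu : ℕ → ℝ)
    (hgl : ∀ K : ℕ, 4 < K → 0 ≤ gl K)
    (hup : ∀ K : ℕ, 4 < K → ∀ u : ℝ, gu K < u → ∀ᶠ σ : ℕ in atTop, b (σ * 4) (σ * K) < u)
    (hlow : ∀ K : ℕ, 4 < K → ∀ l : ℝ, l < gl K → ∀ᶠ σ : ℕ in atTop, l < b (σ * 4) (σ * K))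
    {α : ℝ} (hα : 0 < α)
    (hexpu : Tendsto (fun K : ℕ => Real.log (gu K) / Real.log K) atTop (𝓝 (-α)))
    (hexpl : Tendsto (fun K : ℕ => Real.log (gl K) / Real.log K) atTop (𝓝 (-α))) :
    ∀ ε : ℝ, 0 < ε → ∀ᶠ K : ℕ in atTop, ∀ᶠ σ : ℕ in atTop,
      (K : ℝ) ^ (-α - ε) ≤ b (σ * 4) (σ * K) ∧ b (σ * 4) (σ * K) ≤ (K : ℝ) ^ (-α + ε) := by
  -- it suffices to treat small `ε`
  suffices key : ∀ ε : ℝ, 0 < ε → ε < α → ∀ᶠ K : ℕ in atTop, ∀ᶠ σ : ℕ in atTop,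
      (K : ℝ) ^ (-α - ε) ≤ b (σ * 4) (σ * K) ∧ b (σ * 4) (σ * K) ≤ (K : ℝ) ^ (-α + ε) by
    intro ε hε
    have hε' : 0 < min ε (α / 2) := lt_min hε (by linarith)
    have hε'' : min ε (α / 2) < α := lt_of_le_of_lt (min_le_right _ _) (by linarith)
    filter_upwards [key _ hε' hε'', eventually_ge_atTop 1] with K hK hK1
    have hK1' : (1 : ℝ) ≤ K := by exact_mod_cast hK1
    refine hK.mono fun σ hσ => ⟨le_trans ?_ hσ.1, hσ.2.trans ?_⟩
    · exact Real.rpow_le_rpow_of_exponent_le hK1' (by linarith [min_le_left ε (α / 2)])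
    · exact Real.rpow_le_rpow_of_exponent_le hK1' (by linarith [min_le_left ε (α / 2)])
  intro ε hε hεα
  have hupK : ∀ᶠ K : ℕ in atTop, Real.log (gu K) / Real.log K < -α + ε / 2 :=
    hexpu.eventually_lt_const (by linarith)
  have hlowK : ∀ᶠ K : ℕ in atTop, -α - ε / 2 < Real.log (gl K) / Real.log K :=
    hexpl.eventually_const_lt (by linarith)
  have hlowK' : ∀ᶠ K : ℕ in atTop, Real.log (gl K) / Real.log K < -α + ε / 2 :=
    hexpl.eventually_lt_const (by linarith)
  filter_upwards [hupK, hlowK, hlowK', eventually_gt_atTop 4] with K hKup hKlow hKlow' hK4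
  have hKR : (5 : ℝ) ≤ K := by exact_mod_cast hK4
  have hKpos : (0 : ℝ) < K := by linarith
  have hK1 : (1 : ℝ) ≤ K := by linarith
  have hlogKpos : 0 < Real.log (K : ℝ) := Real.log_pos (by linarith)
  have hup' : Real.log (gu K) < (-α + ε / 2) * Real.log K := (div_lt_iff₀ hlogKpos).1 hKup
  have hlow' : (-α - ε / 2) * Real.log K < Real.log (gl K) := (lt_div_iff₀ hlogKpos).1 hKlow
  have hlow'' : Real.log (gl K) < (-α + ε / 2) * Real.log K := (div_lt_iff₀ hlogKpos).1 hKlow'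
  -- the upper function lies strictly below `K^{-α+ε/2}` (trivially so if it is nonpositive)
  have hU : gu K < (K : ℝ) ^ (-α + ε / 2) := by
    rcases lt_or_ge 0 (gu K) with hpos | hnonpos
    · rw [← Real.log_lt_log_iff hpos (Real.rpow_pos_of_pos hKpos _), Real.log_rpow hKpos]
      exact hup'
    · exact lt_of_le_of_lt hnonpos (Real.rpow_pos_of_pos hKpos _)
  -- the lower function is positive (`log 0 = 0` is excluded by the upper inequality) ...
  have hneg : Real.log (gl K) < 0 :=
    hlow''.trans (mul_neg_of_neg_of_pos (by linarith) hlogKpos)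
  have hglpos : 0 < gl K := by
    rcases (hgl K hK4).lt_or_eq with h | h
    · exact h
    · exfalso
      rw [← h, Real.log_zero] at hneg
      exact lt_irrefl _ hneg
  -- ... and lies strictly above `K^{-α-ε/2}`
  have hL : (K : ℝ) ^ (-α - ε / 2) < gl K := by
    rw [← Real.log_lt_log_iff (Real.rpow_pos_of_pos hKpos _) hglpos, Real.log_rpow hKpos]
    exact hlow'
  filter_upwards [hup K hK4 _ hU, hlow K hK4 _ hL] with σ hσU hσL
  refine ⟨le_trans ?_ hσL.le, hσU.le.trans ?_⟩
  · exact Real.rpow_le_rpow_of_exponent_le hK1 (by linarith)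
  · exact Real.rpow_le_rpow_of_exponent_le hK1 (by linarith)

/-- Sanity check: limits give eventual bounds. If `b(4σ, Kσ) → g(K)` for every `K > 4` then the
hypotheses of `scaleBounds_of_eventualBounds` hold with `g⁻ = g⁺ = g` (and `g ≥ 0` when `b ≥ 0`), so
that `scaleBounds_of_eventualBounds` generalises `scaleBounds_of_natLimit`. [folklore] -/
theorem eventualBounds_of_natLimit (b : ℕ → ℕ → ℝ) (hb0 : ∀ r R, 0 ≤ b r R) (g : ℕ → ℝ)
    (hlim : ∀ K : ℕ, 4 < K → Tendsto (fun σ : ℕ => b (σ * 4) (σ * K)) atTop (𝓝 (g K))) :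
    (∀ K : ℕ, 4 < K → 0 ≤ g K) ∧
    (∀ K : ℕ, 4 < K → ∀ u : ℝ, g K < u → ∀ᶠ σ : ℕ in atTop, b (σ * 4) (σ * K) < u) ∧
    (∀ K : ℕ, 4 < K → ∀ l : ℝ, l < g K → ∀ᶠ σ : ℕ in atTop, l < b (σ * 4) (σ * K)) :=
  ⟨fun K hK => ge_of_tendsto' (hlim K hK) fun _ => hb0 _ _,
    fun K hK _ hu => (hlim K hK).eventually_lt_const hu,
    fun K hK _ hl => (hlim K hK).eventually_const_lt hl⟩

end ArmExponentAssembly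

/-! ### The four-arm exponent from eventual bounds -/

/-- **The four-arm exponent from eventual upper/lower bounds and quasi-multiplicativity at
`p = 1/2`** (Smirnov–Werner 2001, Thm. 4 for `j = 4`, from the two observations of §4, the first
one in portmanteau-ready form). IF for every integer ratio `K > 4` the critical four-arm
probabilities `π₄(4σ, Kσ)` of the hexagonal annuli `Λ_{Kσ} ∖ Λ_{4σ}` are eventually below every
`u > g⁺(K)` and eventually above every `l < g⁻(K)` (SW (16): `limsup`/`liminf` against the
probabilities `g⁺(K)`, `g⁻(K) ≥ 0` of a closed, resp. open, continuum event under the scaling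
limit), where `log g^±(K) / log K → -5/4` (SW (9) with (13)–(15): the radial `SLE₆` derivative
exponent `ν(1) = (4·1 + 1 + √25)/8 = 5/4` of Lawler–Schramm–Werner), and π₄ is quasi-multiplicative
at `p = 1/2` (SW (10); Kesten 1987), THEN `fourArm_exponent` holds. [cite: SmirnovWernerMRL2001, Thm. 4 (j = 4), §4 (9), (10), (16)] -/
theorem fourArm_exponent_of_eventualBounds_crit (gl gu : ℕ → ℝ)
    (hgl : ∀ K : ℕ, 4 < K → 0 ≤ gl K)
    (hup : ∀ K : ℕ, 4 < K → ∀ u : ℝ, gu K < u →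
      ∀ᶠ σ : ℕ in atTop, critFourArmProb (σ * 4) (σ * K) < u)
    (hlow : ∀ K : ℕ, 4 < K → ∀ l : ℝ, l < gl K →
      ∀ᶠ σ : ℕ in atTop, l < critFourArmProb (σ * 4) (σ * K))
    (hexpu : Tendsto (fun K : ℕ => Real.log (gu K) / Real.log K) atTop (𝓝 (-(5 / 4))))
    (hexpl : Tendsto (fun K : ℕ => Real.log (gl K) / Real.log K) atTop (𝓝 (-(5 / 4))))
    (hB : ∃ n₀ : ℕ, ∃ c > (0 : ℝ), ∀ ⦃r R S : ℕ⦄, n₀ ≤ r → 16 * r < 4 * R → 4 * R < S →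
      c * (critFourArmProb r R * critFourArmProb (4 * R) S) ≤ critFourArmProb r S) :
    fourArm_exponent :=
  fourArm_exponent_of_scaleBounds_crit
    (ArmExponentAssembly.scaleBounds_of_eventualBounds (fun r R => critFourArmProb r R) gl gu hgl
      hup hlow (by norm_num) hexpu hexpl) hB

/-- **The four-arm exponent from eventual bounds and `Werner2009_fourArm_quasiMult`**: the same
with the quasi-multiplicativity read off from the tree's near-critical named fact at `t = 1/2`
(`critFourArmProb_quasiMult_of_fact`; Werner 2009, Lecture 6, Cor. 6.2). [cite: SmirnovWernerMRL2001, Thm. 4 (j = 4), §4 (9), (10), (16)] [cite: WernerPCMI2009, Lecture 6, Cor. 6.2] -/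
theorem fourArm_exponent_of_eventualBounds (gl gu : ℕ → ℝ)
    (hgl : ∀ K : ℕ, 4 < K → 0 ≤ gl K)
    (hup : ∀ K : ℕ, 4 < K → ∀ u : ℝ, gu K < u →
      ∀ᶠ σ : ℕ in atTop, critFourArmProb (σ * 4) (σ * K) < u)
    (hlow : ∀ K : ℕ, 4 < K → ∀ l : ℝ, l < gl K →
      ∀ᶠ σ : ℕ in atTop, l < critFourArmProb (σ * 4) (σ * K))
    (hexpu : Tendsto (fun K : ℕ => Real.log (gu K) / Real.log K) atTop (𝓝 (-(5 / 4))))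
    (hexpl : Tendsto (fun K : ℕ => Real.log (gl K) / Real.log K) atTop (𝓝 (-(5 / 4))))
    (hB : Werner2009_fourArm_quasiMult) : fourArm_exponent :=
  fourArm_exponent_of_eventualBounds_crit gl gu hgl hup hlow hexpu hexpl
    (critFourArmProb_quasiMult_of_fact hB)

end Literature.Probability.Percolation
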